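import Mathlib
import Summits.ValiantsHypothesis.ValiantsHypothesis.Theorems.NewtonUnitEquationsTwoProductsRaySplitDefs
import Summits.ValiantsHypothesis.ValiantsHypothesis.Theorems.TwoProducts.Negative.CommonPadding
import Summits.ValiantsHypothesis.ValiantsHypothesis.Theorems.TwoProducts.Negative.HugeCapResidual
import HarnessLib

/-!
# NEGATIVE lane (val-neg-1 g5): DIRECTIONS padding — `C+1` deep common monomial factors in pairwise non-parallel directions

Helper file for crux `stmt-ValiantsHypothesis-5906` (filed `--supports`; closes NO item, proves NO summit statement, does NOT prove
`TwoProducts`, `PlanarCellBound`, any `ResidualLawV…`, `RaySplitLaw` or VP ≠ VNP; 0 `def`s).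

The move (G3): append to both sides the SAME monomial factors `X^{d_i}`, `d_i = N(i+1)·s + e₀` (`s` = sum of all letters, `e₀` a unit
vector with `s × e₀ ≠ 0`, `N` large for the finitely many cell witnesses).  `logDiff` is unchanged (common factors), every cell family is
kept (`isCellFamily_append_common_below`, the pointwise twin of `CommonPadding.isCellFamily_append_common`), and the padded letter set
contains `C+1` pairwise NON-PARALLEL letters — so it lies on no `K ≤ C` rays (`not_raySplit_of_directions`, pigeonhole on `ι`): the
complement of rung R11's hypothesis class «`OnRays` on `K ≤ C` rays ∧ `RayCrossFree`» (val-idea-32 / p3 g16's ✓ `RaySplit.*`) is reachable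
from every instance at the cost `m ↦ m + C + 1`, `t` unchanged.  [folklore]
-/

namespace Summit.ValiantsHypothesis.Theorems.TwoProducts.Negative.DirectionsPadding

open Finset MvPolynomial
open Summit.ValiantsHypothesis.ValiantsHypothesis.Theorems.NewtonUnitEquations.TwoProducts.FormalLogLinearisation
open Summit.ValiantsHypothesis.ValiantsHypothesis.Theorems.NewtonUnitEquations.TwoProducts.PlanarCell
open Summit.ValiantsHypothesis.ValiantsHypothesis.Theorems.NewtonUnitEquations.TwoProducts.RaySplit
open Summit.ValiantsHypothesis.Theorems.TwoProducts.Negative.CommonPadding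
open Summit.ValiantsHypothesis.Theorems.TwoProducts.Negative.HugeCapResidual (eventually_natMul_lt)

variable {m k : ℕ}

/-! ### (1) Cells under a common padding lying BELOW the old letters for the cell witnesses (pointwise form) -/

/-- **Cells are kept under a common padding whose letters lie BELOW the old letters for the cell witnesses.**  Pointwise twin of
`CommonPadding.isCellFamily_append_common`: for each `l ∈ S` one witness valid for both families, with `l` the strict top, inducing `R` on
the old letters, putting every new letter strictly below every old letter, and inducing `Q` on the new letters. [folklore] -/
theorem isCellFamily_append_common_below (u v : Fin m → MvPolynomial (Fin 2) ℂ) (w : Fin k → MvPolynomial (Fin 2) ℂ)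
    (Q R : Expo → Expo → Prop) (S : Finset Expo)
    (hS : ∀ l ∈ S, ∃ ξ : Fin 2 → ℝ, ValidWeight u v ξ ∧ ValidWeight w w ξ ∧ IsStrictTop ξ (logSupport u v) l ∧
      (∀ e ∈ tailSupport u v, ∀ e' ∈ tailSupport u v, (R e e' ↔ wt ξ e ≤ wt ξ e')) ∧
      (∀ e ∈ tailSupport u v, ∀ e' ∈ tailSupport w w, wt ξ e' < wt ξ e) ∧
      (∀ e ∈ tailSupport w w, ∀ e' ∈ tailSupport w w, (Q e e' ↔ wt ξ e ≤ wt ξ e'))) :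
    IsCellFamily (Fin.append u w) (Fin.append v w)
      (fun e e' => (e ∈ tailSupport u v → e' ∈ tailSupport u v ∧ R e e') ∧
        (e ∉ tailSupport u v → e' ∈ tailSupport u v ∨ Q e e')) S := by
  intro l hl
  obtain ⟨ξ, hval, hvalw, htop, hR, hdeep, hQ⟩ := hS l hl
  refine ⟨ξ, (validWeight_append_iff u v w w ξ).2 ⟨hval, hvalw⟩, ?_, ?_⟩
  · rwa [logSupport_append_common]
  · intro e he e' he'
    rw [tailSupport_append, Finset.mem_union] at he he'
    by_cases heT : e ∈ tailSupport u v
    · by_cases heT' : e' ∈ tailSupport u v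
      · -- old / old
        simp only [heT, heT', true_and, forall_true_left, not_true_eq_false, IsEmpty.forall_iff, and_true]
        exact hR e heT e' heT'
      · -- old / new : `e'` is strictly below `e`
        have he'N : e' ∈ tailSupport w w := he'.resolve_left heT'
        have hlt := hdeep e heT e' he'N
        simp only [heT, heT', false_and, forall_true_left, not_true_eq_false, IsEmpty.forall_iff, and_true,
          false_iff, not_le]
        exact hlt
    · have heN : e ∈ tailSupport w w := he.resolve_left heT
      by_cases heT' : e' ∈ tailSupport u v
      · -- new / old
        have hlt := hdeep e' heT' e heN
        simp only [heT, heT', IsEmpty.forall_iff, not_false_eq_true, true_or, forall_true_left, and_self,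
          true_iff]
        exact hlt.le
      · -- new / new
        have he'N : e' ∈ tailSupport w w := he'.resolve_left heT'
        simp only [heT, heT', IsEmpty.forall_iff, not_false_eq_true, false_or, forall_true_left, true_and]
        exact hQ e heN e' he'N

/-! ### (2) Pairwise non-parallel letters exclude every ray structure with few rays -/

/-- **Pigeonhole on rays**: if the letter set `T` contains `C+1` pairwise non-parallel letters, then `T` lies on no `K ≤ C` rays —
whatever the rays, the ray assignment and the cross-freeness (both unused beyond `OnRays`). [folklore] -/
theorem not_raySplit_of_directions {n C : ℕ} (A : Fin n → Finset Expo) (T : Finset Expo) (d : Fin (C + 1) → Expo)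
    (hd : ∀ i, d i ∈ T) (hnp : ∀ i i', i ≠ i' → d i 0 * d i' 1 ≠ d i 1 * d i' 0) :
    ¬ ∃ K, K ≤ C ∧ ∃ (g : Fin K → Expo) (ι : Expo → Fin K) (ν : Expo → ℕ),
        IndepRays g ∧ OnRays g ι ν T ∧ RayCrossFree ι A := by
  rintro ⟨K, hK, g, ι, ν, -, hon, -⟩
  have hcard : Fintype.card (Fin K) < Fintype.card (Fin (C + 1)) := by simp only [Fintype.card_fin]; omega
  obtain ⟨i, i', hne, hι⟩ := Fintype.exists_ne_map_eq_of_card_lt (fun i => ι (d i)) hcard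
  have hi : d i = ν (d i) • g (ι (d i)) := hon (d i) (hd i)
  have hi' : d i' = ν (d i') • g (ι (d i')) := hon (d i') (hd i')
  have hc : ∀ c : Fin 2, d i c = ν (d i) * g (ι (d i)) c := fun c => by
    conv_lhs => rw [hi]
    rw [Finsupp.smul_apply, smul_eq_mul]
  have hc' : ∀ c : Fin 2, d i' c = ν (d i') * g (ι (d i)) c := fun c => by
    conv_lhs => rw [hi']
    rw [Finsupp.smul_apply, smul_eq_mul]
    have hι' : ι (d i') = ι (d i) := hι.symm
    rw [hι']
  exact hnp i i' hne (by rw [hc 0, hc 1, hc' 0, hc' 1]; ring)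

/-! ### (3) The directions padding of an instance -/

/-- **Directions padding.**  A cell family `S ≠ ∅` of a normalised `t`-sparse pair on `m` positions (`t ≥ 1`) is a cell family of a
normalised `t`-sparse pair on `m + (C+1)` positions whose letter set contains `C+1` pairwise non-parallel letters (and all the old ones).
[folklore] -/
theorem directions_padding (C : ℕ) {t : ℕ} (ht : 1 ≤ t) (u v : Fin m → MvPolynomial (Fin 2) ℂ)
    (hu : ∀ j, coeff 0 (u j) = 0 ∧ (u j).support.card ≤ t) (hv : ∀ j, coeff 0 (v j) = 0 ∧ (v j).support.card ≤ t)
    (R : Expo → Expo → Prop) (S : Finset Expo) (hS : IsCellFamily u v R S) (hne : S.Nonempty) :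
    ∃ w : Fin (C + 1) → MvPolynomial (Fin 2) ℂ, ∃ R₀ : Expo → Expo → Prop,
      (∀ j, coeff 0 (Fin.append u w j) = 0 ∧ (Fin.append u w j).support.card ≤ t) ∧
      (∀ j, coeff 0 (Fin.append v w j) = 0 ∧ (Fin.append v w j).support.card ≤ t) ∧
      IsCellFamily (Fin.append u w) (Fin.append v w) R₀ S ∧
      tailSupport u v ⊆ tailSupport (Fin.append u w) (Fin.append v w) ∧
      ∃ d : Fin (C + 1) → Expo, (∀ i, d i ∈ tailSupport (Fin.append u w) (Fin.append v w)) ∧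
        ∀ i i', i ≠ i' → d i 0 * d i' 1 ≠ d i 1 * d i' 0 := by
  classical
  have hu0 : ∀ j, coeff 0 (u j) = 0 := fun j => (hu j).1
  have hv0 : ∀ j, coeff 0 (v j) = 0 := fun j => (hv j).1
  have hT := tailSupport_nonempty_of_isCellFamily hS hne
  have hs0 := tailSum_ne_zero hu0 hv0 hT
  obtain ⟨s, hs⟩ : ∃ s : Expo, s = ∑ f ∈ tailSupport u v, f := ⟨_, rfl⟩
  rw [← hs] at hs0
  -- a unit vector transversal to `s`
  obtain ⟨e₀, he₀, hcross⟩ : ∃ e₀ : Expo, (e₀ 0 = 1 ∧ e₀ 1 = 0 ∨ e₀ 0 = 0 ∧ e₀ 1 = 1) ∧ s 0 * e₀ 1 ≠ s 1 * e₀ 0 := by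
    by_cases h1 : s 1 = 0
    · have h0 : s 0 ≠ 0 := by
        intro h0; apply hs0; ext c; fin_cases c
        · simpa using h0
        · simpa using h1
      refine ⟨Finsupp.single 1 1, Or.inr ⟨by simp, by simp⟩, ?_⟩
      simpa [Finsupp.single_apply, h1] using h0
    · refine ⟨Finsupp.single 0 1, Or.inl ⟨by simp, by simp⟩, ?_⟩
      simpa [Finsupp.single_apply] using Ne.symm h1
  have hspos : 0 < s 0 + s 1 := by
    obtain ⟨c, hc⟩ := Finsupp.ne_iff.mp hs0
    fin_cases c <;> simp only [Finsupp.coe_zero, Pi.zero_apply, Fin.zero_eta, Fin.isValue, Fin.mk_one] at hc <;> omega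
  -- the cell witnesses and the depth `N`
  choose ξ hval htop hR using fun l : S => hS l.1 l.2
  have hsneg : ∀ l : S, wt (ξ l) s < 0 := fun l => hs ▸ wt_tailSum_neg (hval l) hT
  have ev : ∀ p ∈ S.attach ×ˢ tailSupport u v, ∀ᶠ N : ℕ in Filter.atTop,
      (N : ℝ) * wt (ξ p.1) s < wt (ξ p.1) p.2 - wt (ξ p.1) e₀ := by
    intro p hp
    exact eventually_natMul_lt (hsneg p.1) _
  obtain ⟨N, hN, hN1⟩ := (((Filter.eventually_all_finset _).2 ev).and (Filter.eventually_ge_atTop 1)).exists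
  -- the directions and the factors
  obtain ⟨d, hd⟩ : ∃ d : Fin (C + 1) → Expo, d = fun i : Fin (C + 1) => (N * ((i : ℕ) + 1)) • s + e₀ := ⟨_, rfl⟩
  have hdc : ∀ i (c : Fin 2), d i c = N * ((i : ℕ) + 1) * s c + e₀ c := fun i c => by
    simp only [hd, Finsupp.add_apply, Finsupp.smul_apply, smul_eq_mul]
  have hd0 : ∀ i, d i ≠ 0 := by
    intro i h
    rcases he₀ with ⟨h0, -⟩ | ⟨-, h1⟩
    · have h' := congrArg (fun e : Expo => e 0) h
      simp only [hdc, h0, Finsupp.coe_zero, Pi.zero_apply] at h'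
      exact Nat.add_one_ne_zero _ h'
    · have h' := congrArg (fun e : Expo => e 1) h
      simp only [hdc, h1, Finsupp.coe_zero, Pi.zero_apply] at h'
      exact Nat.add_one_ne_zero _ h'
  have hdinj : ∀ i i', d i = d i' → i = i' := by
    intro i i' h
    have h' : (N * ((i : ℕ) + 1)) • s = (N * ((i' : ℕ) + 1)) • s := by
      have := congrArg (fun e : Expo => e - e₀) h
      simpa only [hd, add_tsub_cancel_right] using this
    by_contra hne
    refine nsmul_ne_nsmul hs0 ?_ h'
    intro hm
    apply hne
    ext
    have := Nat.eq_of_mul_eq_mul_left (by omega) hm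
    omega
  obtain ⟨w, hw⟩ : ∃ w : Fin (C + 1) → MvPolynomial (Fin 2) ℂ, w = fun i : Fin (C + 1) => monomial (d i) (1 : ℂ) := ⟨_, rfl⟩
  have hwsupp : ∀ i, (w i).support = {d i} := fun i => by
    rw [hw]
    exact support_monomial.trans (if_neg one_ne_zero)
  have hwn : ∀ i, coeff 0 (w i) = 0 ∧ (w i).support.card ≤ t := fun i => by
    refine ⟨?_, by rw [hwsupp]; simpa using ht⟩
    rw [hw, coeff_monomial, if_neg (hd0 i)]
  have hmemW : ∀ e, e ∈ tailSupport w w ↔ ∃ i, e = d i := fun e => by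
    simp only [tailSupport, Finset.mem_union, Finset.mem_biUnion, Finset.mem_univ, true_and, or_self, hwsupp,
      Finset.mem_singleton]
  -- weights of the new letters
  have hwt : ∀ (l : S) (i : Fin (C + 1)), wt (ξ l) (d i) = ((N * ((i : ℕ) + 1) : ℕ) : ℝ) * wt (ξ l) s + wt (ξ l) e₀ := by
    intro l i
    rw [hd]
    simp only [wt_add, wt_nsmul]
  have hdeep : ∀ (l : S), ∀ e ∈ tailSupport u v, ∀ i, wt (ξ l) (d i) < wt (ξ l) e := by
    intro l e he i
    have h1 := hN (l, e) (Finset.mem_product.2 ⟨Finset.mem_attach _ _, he⟩)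
    have h2 : ((N * ((i : ℕ) + 1) : ℕ) : ℝ) * wt (ξ l) s ≤ (N : ℝ) * wt (ξ l) s :=
      mul_le_mul_of_nonpos_right (by exact_mod_cast Nat.le_mul_of_pos_right N (Nat.succ_pos i)) (hsneg l).le
    rw [hwt]
    simp only at h1
    linarith
  refine ⟨w, _, norm_append u w hu hwn, norm_append v w hv hwn,
    isCellFamily_append_common_below u v w (fun e e' => e' 0 + e' 1 ≤ e 0 + e 1) R S ?_, ?_, d, ?_, ?_⟩
  · intro l hl
    obtain ⟨e₁, he₁⟩ := id hT
    refine ⟨ξ ⟨l, hl⟩, hval ⟨l, hl⟩, ?_, htop ⟨l, hl⟩, hR ⟨l, hl⟩, ?_, ?_⟩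
    · refine ⟨fun j e he => ?_, fun j e he => ?_⟩ <;>
      · rw [hwsupp, Finset.mem_singleton] at he
        subst he
        exact (hdeep ⟨l, hl⟩ e₁ he₁ j).trans (wt_neg_of_mem_tailSupport (hval ⟨l, hl⟩) he₁)
    · intro e he e' he'
      obtain ⟨i, rfl⟩ := (hmemW e').1 he'
      exact hdeep ⟨l, hl⟩ e he i
    · intro e he e' he'
      obtain ⟨i, rfl⟩ := (hmemW e).1 he
      obtain ⟨i', rfl⟩ := (hmemW e').1 he'
      have lhs : d i' 0 + d i' 1 ≤ d i 0 + d i 1 ↔ N * ((i' : ℕ) + 1) ≤ N * ((i : ℕ) + 1) := by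
        simp only [hdc]
        constructor
        · intro h
          exact Nat.le_of_mul_le_mul_right (by linarith) hspos
        · intro h
          have := Nat.mul_le_mul_right (s 0 + s 1) h
          linarith
      have rhs : wt (ξ ⟨l, hl⟩) (d i) ≤ wt (ξ ⟨l, hl⟩) (d i') ↔ N * ((i' : ℕ) + 1) ≤ N * ((i : ℕ) + 1) := by
        simp only [hd, wt_add, add_le_add_iff_right]
        rw [hs]
        exact wt_nsmul_tailSum_le_iff (hval ⟨l, hl⟩) hT _ _
      exact lhs.trans rhs.symm
  · intro e he
    rw [tailSupport_append]
    exact Finset.mem_union_left _ he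
  · intro i
    rw [tailSupport_append]
    exact Finset.mem_union_right _ ((hmemW _).2 ⟨i, rfl⟩)
  · intro i i' hii' h
    have key : ((d i 0 : ℤ) * d i' 1 - d i 1 * d i' 0) =
        (N : ℤ) * ((i : ℤ) - i') * ((s 0 : ℤ) * e₀ 1 - s 1 * e₀ 0) := by
      simp only [hdc]
      push_cast
      ring
    have hz : ((d i 0 : ℤ) * d i' 1 - d i 1 * d i' 0) = 0 := by
      rw [sub_eq_zero]
      exact_mod_cast h
    rw [hz] at key
    rcases mul_eq_zero.1 key.symm with h1 | h1
    · rcases mul_eq_zero.1 h1 with h2 | h2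
      · have : N = 0 := by exact_mod_cast h2
        omega
      · apply hii'
        ext
        have : (i : ℤ) = i' := by linarith
        exact_mod_cast this
    · apply hcross
      have : (s 0 : ℤ) * e₀ 1 = s 1 * e₀ 0 := by linarith
      exact_mod_cast this

end Summit.ValiantsHypothesis.Theorems.TwoProducts.Negative.DirectionsPadding
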